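import Literature.MathematicalPhysics.QuantumFieldTheory.Balaban1983to89.B10Eq27TorusAxialLog
import HarnessLib

/-!
# Line «sandwich_discharge» on crux `HistoryTailL` (stmt-QuantumFields-19936), stub `stub_sandwichSweepGapCapped` — (R0) comb frames,
# word letters: HOW THE COMB TRANSPORT `V(Γ_{c→y})` DEPENDS ON ONE BOND VARIABLE (off the path / forward once / backward once)

Cell `ym3-torus` (YM ladder rung R3 = continuum SU(2) Yang–Mills on the three-torus — a RUNG, NOT the Clay problem: not d = 4, not
infinite volume, not a mass gap), width seat `ym-ust-19936-w5` gen 14, helper letters `--supports stmt-QuantumFields-19936`.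

The B6 door of the capped sweep stub (px8 g7 ARCH-S′ v2, (R0)) frames the sweep directions by the COMB TRANSPORTS of the field,
`G_y(V) = V(Γ_{c→y})` = lit `B10Eq27TorusAxialLog.axialT V c y = holT V c (treeWord (rel c y))` (the staircase word changing the coordinates
in the order `d, …, 1`), and ✓`CovariantDischargeFramedSweepInvariance.framedDir_update_eq` reduces the step-invariance B2″ needs to ONE of
three alternatives for every pair (site `y`, swept bond `b`): the transport to `y` (i) does not read `V_b`, or (ii) traverses `b` ONCE,
FORWARD, after the comb prefix to `b.src`, or (iii) ONCE, BACKWARD, the comb prefix to `b.src` ending with that backward step.  THIS FILE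
proves exactly that for staircase words `ks.flatMap (κ ↦ seg κ (v κ))` (distinct directions `ks`, `treeWord v` is the case
`ks = [d−1, …, 0]`), by elementary word bookkeeping over lit `holT`/`transl`/`seg`:

* §1 direction locality: updating a bond of direction `∉ ks` does not change the transport (`holT_update_eq_of_forall_dir_ne`,
  `holT_update_flatMap_seg_eq`).
* §2 straight segments: the split of a forward/backward segment at its `t`-th bond (`holT_replicate_true_split` / `…_false_split`) and
  update-invariance of a segment that does not pass through the updated bond (`holT_update_replicate_true_eq` / `…_false_eq`).
* §3 no wrap-around along a line: `transl x (t₁•e_κ) = transl x (t₂•e_κ)`, `|t₁ − t₂| < period` ⟹ `t₁ = t₂` (`transl_zsmul_e_inj`).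
* §4 ★★`holT_comb_update_alternatives` — for `ks.Nodup` and `|v κ| < period` on `ks`: the three alternatives with EXPLICIT prefix and
  suffix words (prefix `= ks₁`-legs `++` the first `t` letters of the `b.dir`-leg), each update-invariant in `V_b`.

WHAT THIS IS NOT.  Word algebra in any group; no frames, no measure, no action (the torus-window identification of the prefix with
`axialT V c b.src` and the B2″ package are the sequel `CovariantDischargeCombFrameSweep`).  Nothing of the stub or the rung is proved; NOT Clay.
References: T. Bałaban, CMP **98** (1985) 17–51 [Balaban1985Averaging] ((9) p.18–19 parallel transport along contours; p.24 the combs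
`Γ_{y,x}`); CMP **102** (1985) 255–275 [Balaban1985UV3] ((27) p.263 the contour `Γ_{y,c₋} ∪ c ∪ Γ_{c₊,y}`).  Elementary ([folklore]).
-/

noncomputable section

namespace Summit.QuantumFields.YangMills.Theorems.CovariantDischargeCombWalkLetters

open Literature.MathematicalPhysics.QuantumFieldTheory.Balaban1983to89
open Literature.MathematicalPhysics.QuantumFieldTheory.Balaban1983to89.B10Eq27TorusAxialLog
  (transl transl_apply transl_zero transl_add transl_add_e transl_sub_e holT holT_nil holT_cons_true holT_cons_false holT_append)
open Literature.MathematicalPhysics.QuantumFieldTheory.Balaban1983to89.B7Prop1Explicit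
  (Letter e e_apply seg seg_natCast seg_negSucc mem_seg disp disp_append disp_replicate disp_flatMap disp_seg)

/-! ## §0 Torus translates along a line -/

section Transl

variable {P : Params} {j : ℕ}

/-- `(x + t e_κ) + e_κ = x + (t+1) e_κ`. [folklore] -/
theorem transl_zsmul_shift (x : Site P j) (κ : Fin P.d) (t : ℤ) :
    (transl x (t • e κ)).shift κ = transl x ((t + 1) • e κ) := by
  rw [← transl_add_e, add_zsmul, one_zsmul]

/-- `(x + t e_κ) − e_κ = x + (t−1) e_κ`. [folklore] -/
theorem transl_zsmul_unshift (x : Site P j) (κ : Fin P.d) (t : ℤ) :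
    (transl x (t • e κ)).unshift κ = transl x ((t - 1) • e κ) := by
  rw [← transl_sub_e, sub_zsmul, one_zsmul, sub_eq_add_neg]

/-- `x + e_κ = x.shift κ`. [folklore] -/
theorem transl_e (x : Site P j) (κ : Fin P.d) : transl x (e κ) = x.shift κ := by
  rw [← zero_add (e κ), transl_add_e, transl_zero]

/-- `x − e_κ = x.unshift κ`. [folklore] -/
theorem transl_neg_e (x : Site P j) (κ : Fin P.d) : transl x (-e κ) = x.unshift κ := by
  rw [← zero_sub (e κ), transl_sub_e, transl_zero]

/-- `(x + e_κ) + s e_κ = x + (s+1) e_κ`. [folklore] -/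
theorem transl_shift_zsmul' (x : Site P j) (κ : Fin P.d) (s : ℤ) :
    transl (x.shift κ) (s • e κ) = transl x ((s + 1) • e κ) := by
  rw [← transl_e, ← transl_add, add_zsmul, one_zsmul, add_comm]

/-- `(x − e_κ) + s e_κ = x + (s−1) e_κ`. [folklore] -/
theorem transl_unshift_zsmul' (x : Site P j) (κ : Fin P.d) (s : ℤ) :
    transl (x.unshift κ) (s • e κ) = transl x ((s - 1) • e κ) := by
  rw [← transl_neg_e, ← transl_add, sub_zsmul, one_zsmul, neg_add_eq_sub, sub_eq_add_neg]

end Transl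

variable {P : Params} {j : ℕ} {G : Type*} [Group G]

/-! ## §1 Direction locality -/

section Locality

variable [DecidableEq (PBond P j)]

/-- A word none of whose letters points in the direction of `b` transports `V[b ↦ g]` exactly as `V`. [cite: Balaban1985Averaging, (9) p.18] -/
theorem holT_update_eq_of_forall_dir_ne (V : GaugeField P j G) (b : PBond P j) (g : G) :
    ∀ (x : Site P j) (w : List (Letter P.d)), (∀ l ∈ w, l.1 ≠ b.dir) →
      holT (Function.update V b g) x w = holT V x w
  | x, [], _ => by rw [holT_nil, holT_nil]
  | x, (μ, true) :: w, h => by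
    have hμ : μ ≠ b.dir := h (μ, true) List.mem_cons_self
    have hne : (⟨x, μ⟩ : PBond P j) ≠ b := fun hb => hμ (by rw [← hb])
    rw [holT_cons_true, holT_cons_true, Function.update_of_ne hne,
      holT_update_eq_of_forall_dir_ne V b g (x.shift μ) w (fun l hl => h l (List.mem_cons_of_mem _ hl))]
  | x, (μ, false) :: w, h => by
    have hμ : μ ≠ b.dir := h (μ, false) List.mem_cons_self
    have hne : (⟨x.unshift μ, μ⟩ : PBond P j) ≠ b := fun hb => hμ (by rw [← hb])
    rw [holT_cons_false, holT_cons_false, Function.update_of_ne hne,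
      holT_update_eq_of_forall_dir_ne V b g (x.unshift μ) w (fun l hl => h l (List.mem_cons_of_mem _ hl))]

/-- Staircase legs in directions other than `b.dir` do not read `V_b`. [cite: Balaban1985Averaging, p.24] -/
theorem holT_update_flatMap_seg_eq (V : GaugeField P j G) (b : PBond P j) (g : G) (ks : List (Fin P.d)) (v : Fin P.d → ℤ)
    (hks : b.dir ∉ ks) (x : Site P j) :
    holT (Function.update V b g) x (ks.flatMap fun κ => seg κ (v κ)) = holT V x (ks.flatMap fun κ => seg κ (v κ)) := by
  refine holT_update_eq_of_forall_dir_ne V b g x _ fun l hl => ?_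
  obtain ⟨κ, hκ, hlκ⟩ := List.mem_flatMap.mp hl
  rw [mem_seg hlκ]
  exact fun h => hks (h ▸ hκ)

end Locality

/-! ## §2 Straight segments -/

/-- **FORWARD SEGMENT SPLIT** at its `t`-th bond: `V(x → x+(t+1+m)e_κ) = V(x → x+te_κ)·V(x+te_κ, κ)·V(x+(t+1)e_κ → …)`.
[cite: Balaban1985Averaging, (9) p.18] -/
theorem holT_replicate_true_split (V : GaugeField P j G) (x : Site P j) (κ : Fin P.d) (t m : ℕ) :
    holT V x (List.replicate (t + (m + 1)) (κ, true)) =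
      holT V x (List.replicate t (κ, true)) *
        (V ⟨transl x ((t : ℤ) • e κ), κ⟩ * holT V (transl x (((t : ℤ) + 1) • e κ)) (List.replicate m (κ, true))) := by
  rw [List.replicate_add, holT_append, disp_replicate, Letter.vec_true, List.replicate_succ, holT_cons_true, transl_zsmul_shift]

/-- **BACKWARD SEGMENT SPLIT** at its `t`-th bond: after `t` backward steps the walk stands at `x − te_κ` and the next letter reads the
bond `⟨x − (t+1)e_κ, κ⟩` inverted. [cite: Balaban1985Averaging, (9) p.18] -/
theorem holT_replicate_false_split (V : GaugeField P j G) (x : Site P j) (κ : Fin P.d) (t m : ℕ) :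
    holT V x (List.replicate (t + (m + 1)) (κ, false)) =
      holT V x (List.replicate t (κ, false)) *
        ((V ⟨transl x ((-((t : ℤ) + 1)) • e κ), κ⟩)⁻¹ *
          holT V (transl x ((-((t : ℤ) + 1)) • e κ)) (List.replicate m (κ, false))) := by
  rw [List.replicate_add, holT_append, disp_replicate, Letter.vec_false, List.replicate_succ, holT_cons_false, smul_neg, ← neg_smul,
    transl_zsmul_unshift]
  congr 3 <;> ring_nf

section SegUpdate

variable [DecidableEq (PBond P j)]

/-- A forward segment that does not pass through `b` does not read `V_b`. [cite: Balaban1985Averaging, (9) p.18] -/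
theorem holT_update_replicate_true_eq (V : GaugeField P j G) (b : PBond P j) (g : G) (κ : Fin P.d) :
    ∀ (m : ℕ) (x : Site P j), (∀ t : ℕ, t < m → (⟨transl x ((t : ℤ) • e κ), κ⟩ : PBond P j) ≠ b) →
      holT (Function.update V b g) x (List.replicate m (κ, true)) = holT V x (List.replicate m (κ, true))
  | 0, x, _ => by rw [List.replicate_zero, holT_nil, holT_nil]
  | m + 1, x, h => by
    have h0 : (⟨x, κ⟩ : PBond P j) ≠ b := by
      have h' := h 0 (Nat.succ_pos m)
      rwa [Nat.cast_zero, zero_smul, transl_zero] at h'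
    rw [List.replicate_succ, holT_cons_true, holT_cons_true, Function.update_of_ne h0]
    congr 1
    refine holT_update_replicate_true_eq V b g κ m _ fun t ht => ?_
    rw [transl_shift_zsmul']
    have e1 : (t : ℤ) + 1 = ((t + 1 : ℕ) : ℤ) := by push_cast; ring
    rw [e1]
    exact h (t + 1) (by omega)

/-- A backward segment that does not pass through `b` does not read `V_b`. [cite: Balaban1985Averaging, (9) p.18] -/
theorem holT_update_replicate_false_eq (V : GaugeField P j G) (b : PBond P j) (g : G) (κ : Fin P.d) :
    ∀ (m : ℕ) (x : Site P j), (∀ t : ℕ, t < m → (⟨transl x ((-((t : ℤ) + 1)) • e κ), κ⟩ : PBond P j) ≠ b) →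
      holT (Function.update V b g) x (List.replicate m (κ, false)) = holT V x (List.replicate m (κ, false))
  | 0, x, _ => by rw [List.replicate_zero, holT_nil, holT_nil]
  | m + 1, x, h => by
    have h0 : (⟨x.unshift κ, κ⟩ : PBond P j) ≠ b := by
      have h' := h 0 (Nat.succ_pos m)
      rwa [Nat.cast_zero, zero_add, neg_smul, one_zsmul, transl_neg_e] at h'
    rw [List.replicate_succ, holT_cons_false, holT_cons_false, Function.update_of_ne h0]
    congr 1
    refine holT_update_replicate_false_eq V b g κ m _ fun t ht => ?_
    rw [transl_unshift_zsmul']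
    have e1 : -((t : ℤ) + 1) - 1 = -(((t + 1 : ℕ) : ℤ) + 1) := by push_cast; ring
    rw [e1]
    exact h (t + 1) (by omega)

end SegUpdate

/-! ## §3 No wrap-around along a line -/

section Line

/-- **NO WRAP-AROUND ALONG A LINE**: `x + t₁e_κ = x + t₂e_κ` on the torus with `|t₂ − t₁| <` period forces `t₁ = t₂`. [folklore] -/
theorem transl_zsmul_e_inj {x : Site P j} {κ : Fin P.d} {t₁ t₂ : ℤ}
    (h : transl x (t₁ • e κ) = transl x (t₂ • e κ)) (hlt : (t₂ - t₁).natAbs < P.sitesPerDir j) : t₁ = t₂ := by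
  have hκ := congrFun h κ
  simp only [transl_apply, Pi.smul_apply, smul_eq_mul, e_apply, if_true, mul_one] at hκ
  have h1 : ((t₁ : ℤ) : ZMod (P.sitesPerDir j)) = ((t₂ : ℤ) : ZMod (P.sitesPerDir j)) := add_left_cancel hκ
  rw [ZMod.intCast_eq_intCast_iff_dvd_sub] at h1
  have h2 : t₂ - t₁ = 0 :=
    Int.eq_zero_of_abs_lt_dvd h1 (by rw [Int.abs_eq_natAbs]; exact_mod_cast hlt)
  omega

/-- … hence distinct parameters on a short line give distinct bonds. [folklore] -/
theorem bond_transl_ne {x : Site P j} {κ : Fin P.d} {t₁ t₂ : ℤ} (hne : t₁ ≠ t₂)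
    (hlt : (t₂ - t₁).natAbs < P.sitesPerDir j) :
    (⟨transl x (t₁ • e κ), κ⟩ : PBond P j) ≠ ⟨transl x (t₂ • e κ), κ⟩ := fun h =>
  hne (transl_zsmul_e_inj (PBond.mk.inj h).1 hlt)

/-! ## §4 One bond against a forward / backward segment, and against a staircase word -/

/-- A bond of direction `κ` against the FORWARD segment of `n <` period steps from `x`: either the segment misses it, or it is its
`t`-th bond, the first `t` bonds and the last `n − t − 1` bonds (read from `b.tgt = x + (t+1)e_κ`) miss it. [cite: Balaban1985Averaging, (9) p.18] -/
theorem forward_segment_alternatives (x : Site P j) (κ : Fin P.d) (n : ℕ) (hn : n < P.sitesPerDir j) (b : PBond P j)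
    (hb : b.dir = κ) :
    (∀ t' : ℕ, t' < n → (⟨transl x ((t' : ℤ) • e κ), κ⟩ : PBond P j) ≠ b) ∨
      ∃ t : ℕ, t < n ∧ b = ⟨transl x ((t : ℤ) • e κ), κ⟩ ∧ b.tgt = transl x (((t : ℤ) + 1) • e κ) ∧
        (∀ t' : ℕ, t' < t → (⟨transl x ((t' : ℤ) • e κ), κ⟩ : PBond P j) ≠ b) ∧
        (∀ t' : ℕ, t' < n - (t + 1) → (⟨transl (transl x (((t : ℤ) + 1) • e κ)) ((t' : ℤ) • e κ), κ⟩ : PBond P j) ≠ b) := by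
  by_cases h : ∃ t : ℕ, t < n ∧ b.src = transl x ((t : ℤ) • e κ)
  · obtain ⟨t, ht, hsrc⟩ := h
    have hbeq : b = ⟨transl x ((t : ℤ) • e κ), κ⟩ := by
      cases b; simp only at hsrc hb; rw [hsrc, hb]
    refine Or.inr ⟨t, ht, hbeq, ?_, ?_, ?_⟩
    · rw [hbeq, PBond.tgt, transl_zsmul_shift]
    · intro t' ht'
      rw [hbeq]
      exact bond_transl_ne (by exact_mod_cast ht'.ne) (by
        have : ((t : ℤ) - (t' : ℤ)).natAbs = t - t' := by omega
        rw [this]; omega)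
    · intro t' ht'
      rw [hbeq, ← transl_add, ← add_zsmul]
      exact bond_transl_ne (by omega) (by
        have : ((t : ℤ) - ((t : ℤ) + 1 + (t' : ℤ))).natAbs = t' + 1 := by omega
        rw [this]; omega)
  · refine Or.inl fun t' ht' hb' => h ⟨t', ht', ?_⟩
    rw [← hb']

/-- A bond of direction `κ` against the BACKWARD segment of `n <` period steps from `x`: either it misses it, or it is its `t`-th bond
`⟨x − (t+1)e_κ, κ⟩`, the first `t` bonds and the last `n − t − 1` (read from `b.src`) miss it. [cite: Balaban1985Averaging, (9) p.18] -/
theorem backward_segment_alternatives (x : Site P j) (κ : Fin P.d) (n : ℕ) (hn : n < P.sitesPerDir j) (b : PBond P j)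
    (hb : b.dir = κ) :
    (∀ t' : ℕ, t' < n → (⟨transl x ((-((t' : ℤ) + 1)) • e κ), κ⟩ : PBond P j) ≠ b) ∨
      ∃ t : ℕ, t < n ∧ b = ⟨transl x ((-((t : ℤ) + 1)) • e κ), κ⟩ ∧
        (∀ t' : ℕ, t' < t → (⟨transl x ((-((t' : ℤ) + 1)) • e κ), κ⟩ : PBond P j) ≠ b) ∧
        (∀ t' : ℕ, t' < n - (t + 1) →
          (⟨transl (transl x ((-((t : ℤ) + 1)) • e κ)) ((-((t' : ℤ) + 1)) • e κ), κ⟩ : PBond P j) ≠ b) := by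
  by_cases h : ∃ t : ℕ, t < n ∧ b.src = transl x ((-((t : ℤ) + 1)) • e κ)
  · obtain ⟨t, ht, hsrc⟩ := h
    have hbeq : b = ⟨transl x ((-((t : ℤ) + 1)) • e κ), κ⟩ := by
      cases b; simp only at hsrc hb; rw [hsrc, hb]
    refine Or.inr ⟨t, ht, hbeq, ?_, ?_⟩
    · intro t' ht'
      rw [hbeq]
      exact bond_transl_ne (by omega) (by
        have : (-((t : ℤ) + 1) - -((t' : ℤ) + 1)).natAbs = t - t' := by omega
        rw [this]; omega)
    · intro t' ht'
      rw [hbeq, ← transl_add, ← add_zsmul]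
      exact bond_transl_ne (by omega) (by
        have : (-((t : ℤ) + 1) - (-((t : ℤ) + 1) + -((t' : ℤ) + 1))).natAbs = t' + 1 := by omega
        rw [this]; omega)
  · refine Or.inl fun t' ht' hb' => h ⟨t', ht', ?_⟩
    rw [← hb']

end Line

section Comb

variable [DecidableEq (PBond P j)]

/-- ★★ **ONE BOND AGAINST A STAIRCASE WORD — THE THREE ALTERNATIVES.**  For distinct directions `ks`, leg lengths `|v κ| <` period, a base
`x` and a bond `b`: the transport `V ↦ holT V x (ks.flatMap (κ ↦ seg κ (v κ)))` either (i) does not read `V_b`; or (ii) `b` is the `t`-th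
bond of the FORWARD `b.dir`-leg: `ks = ks₁ ++ b.dir :: ks₂`, the prefix (`ks₁`-legs then `t` forward letters) and the suffix (the remaining
`v(b.dir) − t − 1` forward letters from `b.tgt`, then the `ks₂`-legs) do not read `V_b`, and the transport factors as `prefix · V_b · suffix`;
or (iii) the BACKWARD twin with `V_b⁻¹`, the suffix read from `b.src`. [cite: Balaban1985Averaging, (9) p.18, p.24] -/
theorem holT_comb_update_alternatives (b : PBond P j) (v : Fin P.d → ℤ) :
    ∀ (ks : List (Fin P.d)) (x : Site P j), ks.Nodup → (∀ κ ∈ ks, (v κ).natAbs < P.sitesPerDir j) →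
      (∀ (V : GaugeField P j G) (g : G),
          holT (Function.update V b g) x (ks.flatMap fun κ => seg κ (v κ)) = holT V x (ks.flatMap fun κ => seg κ (v κ))) ∨
      (∃ (ks₁ ks₂ : List (Fin P.d)) (t : ℕ), ks = ks₁ ++ b.dir :: ks₂ ∧ (t : ℤ) + 1 ≤ v b.dir ∧
          b = ⟨transl (transl x (disp (ks₁.flatMap fun κ => seg κ (v κ)))) ((t : ℤ) • e b.dir), b.dir⟩ ∧
          (∀ (V : GaugeField P j G) (g : G),
            holT (Function.update V b g) x ((ks₁.flatMap fun κ => seg κ (v κ)) ++ List.replicate t (b.dir, true)) =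
              holT V x ((ks₁.flatMap fun κ => seg κ (v κ)) ++ List.replicate t (b.dir, true))) ∧
          (∀ (V : GaugeField P j G) (g : G),
            holT (Function.update V b g) b.tgt
                (List.replicate ((v b.dir).toNat - (t + 1)) (b.dir, true) ++ ks₂.flatMap fun κ => seg κ (v κ)) =
              holT V b.tgt (List.replicate ((v b.dir).toNat - (t + 1)) (b.dir, true) ++ ks₂.flatMap fun κ => seg κ (v κ))) ∧
          (∀ V : GaugeField P j G, holT V x (ks.flatMap fun κ => seg κ (v κ)) =
            holT V x ((ks₁.flatMap fun κ => seg κ (v κ)) ++ List.replicate t (b.dir, true)) *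
              (V b * holT V b.tgt
                (List.replicate ((v b.dir).toNat - (t + 1)) (b.dir, true) ++ ks₂.flatMap fun κ => seg κ (v κ))))) ∨
      (∃ (ks₁ ks₂ : List (Fin P.d)) (t : ℕ), ks = ks₁ ++ b.dir :: ks₂ ∧ (t : ℤ) + 1 ≤ -v b.dir ∧
          b = ⟨transl (transl x (disp (ks₁.flatMap fun κ => seg κ (v κ)))) ((-((t : ℤ) + 1)) • e b.dir), b.dir⟩ ∧
          (∀ (V : GaugeField P j G) (g : G),
            holT (Function.update V b g) x ((ks₁.flatMap fun κ => seg κ (v κ)) ++ List.replicate t (b.dir, false)) =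
              holT V x ((ks₁.flatMap fun κ => seg κ (v κ)) ++ List.replicate t (b.dir, false))) ∧
          (∀ (V : GaugeField P j G) (g : G),
            holT (Function.update V b g) b.src
                (List.replicate ((-v b.dir).toNat - (t + 1)) (b.dir, false) ++ ks₂.flatMap fun κ => seg κ (v κ)) =
              holT V b.src (List.replicate ((-v b.dir).toNat - (t + 1)) (b.dir, false) ++ ks₂.flatMap fun κ => seg κ (v κ))) ∧
          (∀ V : GaugeField P j G, holT V x (ks.flatMap fun κ => seg κ (v κ)) =
            holT V x ((ks₁.flatMap fun κ => seg κ (v κ)) ++ List.replicate t (b.dir, false)) *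
              ((V b)⁻¹ * holT V b.src
                (List.replicate ((-v b.dir).toNat - (t + 1)) (b.dir, false) ++ ks₂.flatMap fun κ => seg κ (v κ)))))
  | [], x, _, _ => Or.inl fun V g => by rw [List.flatMap_nil, holT_nil, holT_nil]
  | κ :: ks, x, hnd, hv => by
    have hκ : κ ∉ ks := (List.nodup_cons.mp hnd).1
    have hnd' : ks.Nodup := (List.nodup_cons.mp hnd).2
    have hv' : ∀ κ' ∈ ks, (v κ').natAbs < P.sitesPerDir j := fun κ' h => hv κ' (List.mem_cons_of_mem κ h)
    have hvκ : (v κ).natAbs < P.sitesPerDir j := hv κ List.mem_cons_self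
    rw [List.flatMap_cons]
    by_cases hdir : b.dir = κ
    · -- the updated bond points along this leg: the other legs never read it
      subst hdir
      have hrest : ∀ (y : Site P j) (V : GaugeField P j G) (g : G),
          holT (Function.update V b g) y (ks.flatMap fun κ => seg κ (v κ)) = holT V y (ks.flatMap fun κ => seg κ (v κ)) :=
        fun y V g => holT_update_flatMap_seg_eq V b g ks v hκ y
      rcases Int.eq_nat_or_neg (v b.dir) with ⟨n, hn | hn⟩
      · -- FORWARD leg of `n` letters
        have hnN : n < P.sitesPerDir j := by rw [hn] at hvκ; simpa using hvκ
        rcases forward_segment_alternatives x b.dir n hnN b rfl with hmiss | ⟨t, ht, hbeq, htgt, hpre, hsuf⟩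
        · left
          intro V g
          rw [holT_append, holT_append, hn, seg_natCast, holT_update_replicate_true_eq V b g b.dir n x hmiss, hrest]
        · right; left
          obtain ⟨m, rfl⟩ : ∃ m, n = t + (m + 1) := ⟨n - (t + 1), by omega⟩
          have htoNat : (v b.dir).toNat - (t + 1) = m := by rw [hn, Int.toNat_natCast]; omega
          have hsuf' : ∀ t' : ℕ, t' < m →
              (⟨transl (transl x (((t : ℤ) + 1) • e b.dir)) ((t' : ℤ) • e b.dir), b.dir⟩ : PBond P j) ≠ b :=
            fun t' ht' => hsuf t' (by omega)
          refine ⟨[], ks, t, by simp, by rw [hn]; push_cast; omega, ?_, ?_, ?_, ?_⟩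
          · rw [List.flatMap_nil, B7Prop1Explicit.disp_nil, transl_zero]; exact hbeq
          · intro V g
            rw [List.flatMap_nil, List.nil_append]
            exact holT_update_replicate_true_eq V b g b.dir t x hpre
          · intro V g
            rw [htoNat, holT_append, holT_append, htgt, holT_update_replicate_true_eq V b g b.dir m _ hsuf', hrest]
          · intro V
            have hVb : V ⟨transl x ((t : ℤ) • e b.dir), b.dir⟩ = V b := by rw [← hbeq]
            have e2 : (((t + (m + 1) : ℕ) : ℤ)) • e b.dir = ((t : ℤ) + 1) • e b.dir + (m : ℤ) • e b.dir := by
              rw [← add_zsmul]; congr 1; push_cast; ring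
            rw [htoNat, List.flatMap_nil, List.nil_append, hn, seg_natCast, holT_append, holT_replicate_true_split, hVb,
              disp_replicate, Letter.vec_true, e2, transl_add, holT_append, htgt, disp_replicate, Letter.vec_true]
            simp only [mul_assoc]
      · -- BACKWARD leg of `n` letters
        have hnN : n < P.sitesPerDir j := by rw [hn] at hvκ; simpa using hvκ
        rcases backward_segment_alternatives x b.dir n hnN b rfl with hmiss | ⟨t, ht, hbeq, hpre, hsuf⟩
        · left
          intro V g
          rw [holT_append, holT_append, hn, B7Prop1Explicit.seg_neg_natCast,
            holT_update_replicate_false_eq V b g b.dir n x hmiss, hrest]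
        · right; right
          obtain ⟨m, rfl⟩ : ∃ m, n = t + (m + 1) := ⟨n - (t + 1), by omega⟩
          have htoNat : (-v b.dir).toNat - (t + 1) = m := by rw [hn, neg_neg, Int.toNat_natCast]; omega
          have hsrc : b.src = transl x ((-((t : ℤ) + 1)) • e b.dir) := by rw [hbeq]
          have hsuf' : ∀ t' : ℕ, t' < m →
              (⟨transl (transl x ((-((t : ℤ) + 1)) • e b.dir)) ((-((t' : ℤ) + 1)) • e b.dir), b.dir⟩ : PBond P j) ≠ b :=
            fun t' ht' => hsuf t' (by omega)
          refine ⟨[], ks, t, by simp, by rw [hn]; push_cast; omega, ?_, ?_, ?_, ?_⟩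
          · rw [List.flatMap_nil, B7Prop1Explicit.disp_nil, transl_zero]; exact hbeq
          · intro V g
            rw [List.flatMap_nil, List.nil_append]
            exact holT_update_replicate_false_eq V b g b.dir t x hpre
          · intro V g
            rw [htoNat, holT_append, holT_append, hsrc, holT_update_replicate_false_eq V b g b.dir m _ hsuf', hrest]
          · intro V
            have hVb : V ⟨transl x ((-((t : ℤ) + 1)) • e b.dir), b.dir⟩ = V b := by rw [← hbeq]
            have e2 : (-(((t + (m + 1) : ℕ) : ℤ))) • e b.dir = (-((t : ℤ) + 1)) • e b.dir + (-(m : ℤ)) • e b.dir := by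
              rw [← add_zsmul]; congr 1; push_cast; ring
            rw [htoNat, List.flatMap_nil, List.nil_append, hn, B7Prop1Explicit.seg_neg_natCast, holT_append,
              holT_replicate_false_split, hVb, disp_replicate, Letter.vec_false, smul_neg, ← neg_smul, e2, transl_add,
              holT_append, hsrc, disp_replicate, Letter.vec_false, smul_neg, ← neg_smul]
            simp only [mul_assoc]
    · -- the updated bond points elsewhere: this leg never reads it; recurse on the remaining legs
      have hseg : ∀ (V : GaugeField P j G) (g : G),
          holT (Function.update V b g) x (seg κ (v κ)) = holT V x (seg κ (v κ)) := fun V g =>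
        holT_update_eq_of_forall_dir_ne V b g x _ fun l hl => by rw [mem_seg hl]; exact Ne.symm hdir
      rcases holT_comb_update_alternatives b v ks (transl x (v κ • e κ)) hnd' hv' with
        h1 | ⟨ks₁, ks₂, t, hks, ht, hbeq, hpre, hsuf, hfac⟩ | ⟨ks₁, ks₂, t, hks, ht, hbeq, hpre, hsuf, hfac⟩
      · left
        intro V g
        rw [holT_append, holT_append, hseg, disp_seg, h1]
      · right; left
        refine ⟨κ :: ks₁, ks₂, t, by rw [hks]; rfl, ht, ?_, ?_, hsuf, ?_⟩
        · rw [hbeq, List.flatMap_cons, disp_append, disp_seg, transl_add]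
        · intro V g
          have hp := hpre V g
          rw [List.flatMap_cons, List.append_assoc]
          simp only [holT_append, disp_seg] at hp ⊢
          rw [hseg, hp]
        · intro V
          rw [List.flatMap_cons, List.append_assoc]
          conv_lhs => rw [holT_append, disp_seg, hfac]
          conv_rhs => rw [holT_append, disp_seg]
          rw [mul_assoc]
      · right; right
        refine ⟨κ :: ks₁, ks₂, t, by rw [hks]; rfl, ht, ?_, ?_, hsuf, ?_⟩
        · rw [hbeq, List.flatMap_cons, disp_append, disp_seg, transl_add]
        · intro V g
          have hp := hpre V g
          rw [List.flatMap_cons, List.append_assoc]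
          simp only [holT_append, disp_seg] at hp ⊢
          rw [hseg, hp]
        · intro V
          rw [List.flatMap_cons, List.append_assoc]
          conv_lhs => rw [holT_append, disp_seg, hfac]
          conv_rhs => rw [holT_append, disp_seg]
          rw [mul_assoc]

end Comb

end Summit.QuantumFields.YangMills.Theorems.CovariantDischargeCombWalkLetters
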